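import Summits.QuantumFields.YangMills.Theorems.SwapVirialDeficitSwapRingCeilingBonds
import Summits.QuantumFields.YangMills.Theorems.TwistEaterVolumeQuadraticGrowthRing
import HarnessLib

/-!
# The fixed-`L` swap CEILING, box (B-i) for the TWISTED sectors `z ≠ 0`: the sign-stripped seam and the signed σ-relations
# (LEAD g93's 07:01Z split: general `z` on top of w3 g61's ✓`SwapRingCeilingBonds` / `SwapRingCeilingBox`; brick (B-i) of w2 g54's swap-ceiling plan;
# free-hands support of ⟨stmt-QuantumFields-24197⟩ `SwapVirialDeficit.SwapGluedStiffness`)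

For the σ-glued ring closed through `K(P_{2L−1}, g·tw_z(σP₀))` in an ARBITRARY seam sector `z ∈ (ℤ/2)³` the twist ✓`twist3_apply` multiplies the links
LEAVING the planes `x_k = 0` by `centreElem (z k)`; the comb tree crosses each such plane once per leg, so a small deficit no longer forces the seam
field to be near-constant but near `centreElem(π_z(x))·g 0` with the PARITY `π_z(x) = ⊕_k (z k ∧ x_k ≠ 0)` (§1–§2), and the seam value intertwines the
wrap letters WITH SIGNS, `‖g0·C_{σμ} − centreElem(z μ)·C_μ·g0‖_F ≤ 52L³δ` (§3; uniformly in `L`).  ★★ `swapCommBox_of_swapRingDeficit_twisted` (§4)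
collects the five box conditions with `δ = √F^S_z` (wrap commutators, letters and slices are w3's z-general ✓`swap_wraps_comm` / ✓`swap_letters_near` /
✓`swap_slices_near`).  For `z = 0` the parity is `false` and the signs are `1`: w3's principal-sector box.  Consumers: (B-iii)/(B-iv) (w2 g54) and (B-v).
HONEST LABEL: deterministic Frobenius-norm bookkeeping on a fixed lattice; ⟨24197⟩ ⟨24194⟩ ⟨24497⟩ stay OPEN; no crux, rung or summit is proved;
the Yang–Mills mass gap is NOT proved; no summit is proved by a line.  Seat ym-line-fcl-p3 g43 (cell ym-idea-1, free hands;
`--supports stmt-QuantumFields-24197`).  THEOREMS ONLY (0 `def`, 0 `sorry`), standard axioms.  References: [cite: tHooft1979]; [cite: Luscher1983, §2]; [folklore].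
-/

set_option autoImplicit false

noncomputable section

open scoped Quaternion Matrix BigOperators Matrix.Norms.Frobenius
open Literature.MathematicalPhysics.QuantumFieldTheory hiding SU2
open Literature.MathematicalPhysics.QuantumLattice

namespace Summit.QuantumFields.YangMills.Theorems.SwapVirialDeficit.SwapRingTwisted

open Summit.QuantumFields.YangMills.Theorems.FemtoTransferGap
open Summit.QuantumFields.YangMills.Theorems.FemtoTransferGap.TT
open Summit.QuantumFields.YangMills.Theorems.FemtoTransferGap.TwoLattice
open Summit.QuantumFields.YangMills.Theorems.FemtoTransferGap.TwoLattice.Flat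
open Summit.QuantumFields.YangMills.Theorems.FemtoTransferGap.TwoLattice.Cov
open Summit.QuantumFields.YangMills.Theorems.VirialFluxGap.RingDeficit
open Summit.QuantumFields.YangMills.Theorems.ToronValleyVolume.Lojasiewicz
open Summit.QuantumFields.YangMills.Theorems.ToronValleyVolume.PeriodicRingCeiling
open Summit.QuantumFields.YangMills.Theorems.SwapTwistDeficit.PeriodicRingFloor
open Summit.QuantumFields.YangMills.Theorems.SwapVirialDeficit.SwapRing
open Summit.QuantumFields.YangMills.Theorems.TwistEaterVolume.Quadratic

variable {L : ℕ} [NeZero L]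

/-! ## §1 Centre elements, twist factors and the parity `π_z` -/

/-- Centre elements commute with everything. [folklore] -/
theorem centreElem_mul_comm (b : Bool) (g : SU2) : centreElem b * g = g * centreElem b := by
  cases b
  · simp [centreElem]
  · simp only [centreElem, if_true]; exact negOne_mul_comm g

/-- A conditional centre element is a centre element. [folklore] -/
theorem ite_centreElem (p : Prop) [Decidable p] (b : Bool) : (if p then centreElem b else (1 : SU2)) = centreElem (b && decide p) := by
  by_cases hp : p
  · rw [if_pos hp]; cases b <;> simp [centreElem, hp]
  · rw [if_neg hp]; cases b <;> simp [centreElem, hp]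

/-- Stripping signs: `fd ((centreElem (b ⊕ a))⁻¹·X) ((centreElem a)⁻¹·Y) = fd X (centreElem b · Y)`. [folklore] -/
theorem fd_strip (a b : Bool) (X Y : SU2) :
    fd ((centreElem (Bool.xor b a))⁻¹ * X) ((centreElem a)⁻¹ * Y) = fd X (centreElem b * Y) := by
  rw [← centreElem_mul, mul_inv_rev, centreElem_inv, centreElem_inv, mul_assoc, fd_mul_left, ← fd_mul_left (centreElem b),
    ← mul_assoc (centreElem b) (centreElem b) X, centreElem_mul_self, one_mul]

omit [NeZero L] in
/-- ★ **The parity propagates along edges off the far faces**: for `x_k ≠ −1`,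
`π_z(x + ê_k) = (z k ∧ x_k = 0) ⊕ π_z(x)`. [folklore] -/
theorem parity_shift (z : Fin 3 → Bool) (x : Site 3 L) (k : Fin 3) (hx : x k ≠ -1) :
    Bool.xor (z 0 && decide (x.shift k 0 ≠ 0)) (Bool.xor (z 1 && decide (x.shift k 1 ≠ 0)) (z 2 && decide (x.shift k 2 ≠ 0))) =
      Bool.xor (z k && decide (x k = 0))
        (Bool.xor (z 0 && decide (x 0 ≠ 0)) (Bool.xor (z 1 && decide (x 1 ≠ 0)) (z 2 && decide (x 2 ≠ 0)))) := by
  have hk1 : x k + 1 ≠ 0 := fun h => hx (eq_neg_of_add_eq_zero_left h)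
  have hsk : (x.shift k) k = x k + 1 := by simp [Site.shift]
  have hsame : decide (x.shift k k ≠ 0) = true := by rw [hsk]; exact decide_eq_true hk1
  have hother : ∀ j : Fin 3, j ≠ k → decide (x.shift k j ≠ 0) = decide (x j ≠ 0) := by
    intro j hj; rw [shift_apply_ne x hj]
  have hdec : decide (x k = 0) = !decide (x k ≠ 0) := by
    by_cases h : x k = 0 <;> simp [h]
  have hk : k = 0 ∨ k = 1 ∨ k = 2 := by fin_cases k <;> simp
  rcases hk with rfl | rfl | rfl
  · rw [hsame, hother 1 (by decide), hother 2 (by decide), hdec]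
    generalize z 0 = c
    generalize decide (x 0 ≠ 0) = b
    generalize Bool.xor (z 1 && decide (x 1 ≠ 0)) (z 2 && decide (x 2 ≠ 0)) = R
    revert c b R; decide
  · rw [hsame, hother 0 (by decide), hother 2 (by decide), hdec]
    generalize z 1 = c
    generalize decide (x 1 ≠ 0) = b
    generalize (z 0 && decide (x 0 ≠ 0)) = A
    generalize (z 2 && decide (x 2 ≠ 0)) = C
    revert c b A C; decide
  · rw [hsame, hother 0 (by decide), hother 1 (by decide), hdec]
    generalize z 2 = c
    generalize decide (x 2 ≠ 0) = b
    generalize (z 0 && decide (x 0 ≠ 0)) = A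
    generalize (z 1 && decide (x 1 ≠ 0)) = B
    revert c b A B; decide

omit [NeZero L] in
/-- The parity of the origin is `false`. [folklore] -/
theorem parity_zero (z : Fin 3 → Bool) :
    Bool.xor (z 0 && decide ((0 : Site 3 L) 0 ≠ 0)) (Bool.xor (z 1 && decide ((0 : Site 3 L) 1 ≠ 0)) (z 2 && decide ((0 : Site 3 L) 2 ≠ 0))) = false := by
  simp

omit [NeZero L] in
/-- At the wrap site `−ê_k` the parity and the twist factor of the wrap edge combine to `z k`, whatever `L`. [folklore] -/
theorem parity_wrap_xor (z : Fin 3 → Bool) (k : Fin 3) :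
    Bool.xor (z k && decide ((Pi.single k (-1 : ZMod L) : Site 3 L) k = 0))
      (Bool.xor (z 0 && decide ((Pi.single k (-1 : ZMod L) : Site 3 L) 0 ≠ 0))
        (Bool.xor (z 1 && decide ((Pi.single k (-1 : ZMod L) : Site 3 L) 1 ≠ 0)) (z 2 && decide ((Pi.single k (-1 : ZMod L) : Site 3 L) 2 ≠ 0)))) = z k := by
  fin_cases k
  · simp only [Fin.zero_eta, Fin.isValue, Pi.single_eq_same, ne_eq, Pi.single_eq_of_ne (show (1 : Fin 3) ≠ 0 by decide),
      Pi.single_eq_of_ne (show (2 : Fin 3) ≠ 0 by decide), not_true_eq_false, decide_false, Bool.and_false, Bool.xor_false]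
    by_cases h : (-1 : ZMod L) = 0
    · simp [h]
    · simp [h]
  · simp only [Fin.mk_one, Fin.isValue, Pi.single_eq_same, ne_eq, Pi.single_eq_of_ne (show (0 : Fin 3) ≠ 1 by decide),
      Pi.single_eq_of_ne (show (2 : Fin 3) ≠ 1 by decide), not_true_eq_false, decide_false, Bool.and_false, Bool.false_xor, Bool.xor_false]
    by_cases h : (-1 : ZMod L) = 0
    · simp [h]
    · simp [h]
  · simp only [Fin.reduceFinMk, Fin.isValue, Pi.single_eq_same, ne_eq, Pi.single_eq_of_ne (show (0 : Fin 3) ≠ 2 by decide),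
      Pi.single_eq_of_ne (show (1 : Fin 3) ≠ 2 by decide), not_true_eq_false, decide_false, Bool.and_false, Bool.false_xor]
    by_cases h : (-1 : ZMod L) = 0
    · simp [h]
    · simp [h]

/-! ## §2 The seam field: jumps across tree edges and nearness to `centreElem(π_z)·g 0` -/

/-- On a tree edge `e` of the comb, the σ-swapped glued slice is within `12L²·√F^S_z` of `1` (its σ-image is a tree edge or a letter-`1` link,
`x_k ≠ −1` being σ-invariant). [folklore] -/
theorem fd_configPerm_glue_tree_le (z : Fin 3 → Bool) (w : OffIdx L → SU2) (r : Fin (2 * L - 1) → GaugeConfig 3 L SU2) (g : Site 3 L → SU2)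
    {e : Edge 3 L} (he : treeEdge e = true) :
    fd (configPerm (Equiv.swap (0 : Fin 3) 1) (glue w) e) 1 ≤
      12 * (L : ℝ) ^ 2 * Real.sqrt (swapRingDeficit L z ((Fin.cons (glue w) r : Fin (2 * L - 1 + 1) → GaugeConfig 3 L SU2), g)) := by
  set P : (Fin (2 * L - 1 + 1) → GaugeConfig 3 L SU2) × (Site 3 L → SU2) := (Fin.cons (glue w) r, g) with hP
  set δ := Real.sqrt (swapRingDeficit L z P) with hδ
  have hδ0 : 0 ≤ δ := Real.sqrt_nonneg _
  have hL1 : (1 : ℝ) ≤ L := by exact_mod_cast NeZero.one_le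
  have hL0 : (0 : ℝ) ≤ (L : ℝ) - 1 := by linarith
  rw [configPerm_apply]
  set e' : Edge 3 L := (sitePerm (Equiv.swap (0 : Fin 3) 1).symm e.1, (Equiv.swap (0 : Fin 3) 1).symm e.2) with he'
  have hcoord : e'.1 e'.2 = e.1 e.2 := by
    simp only [he', sitePerm_apply, Equiv.symm_swap, Equiv.swap_apply_self]
  have hne : e'.1 e'.2 ≠ -1 := by rw [hcoord]; exact apply_ne_neg_one_of_treeEdge he
  by_cases ht : treeEdge e' = true
  · rw [glue_apply_of_tree w ht, fd_self]; positivity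
  · have hS : Real.sqrt (2 * wilsonAction su2Rep (glue w)) ≤ 2 * δ := by
      have h := sqrt_two_action_le_swap z P
      have hP1 : P.1 0 = glue w := rfl
      rwa [hP1] at h
    have h := fd_treeFix_combFlat_le (glue w) e'
    rw [treeFix_glue, combFlat_apply, if_neg hne] at h
    calc fd (glue w e') 1 ≤ ((L : ℝ) - 1) * ((6 * (L : ℝ) - 4) * Real.sqrt (2 * wilsonAction su2Rep (glue w))) := h
      _ ≤ ((L : ℝ) - 1) * ((6 * (L : ℝ) - 4) * (2 * δ)) :=
          mul_le_mul_of_nonneg_left (mul_le_mul_of_nonneg_left hS (by linarith)) hL0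
      _ ≤ 12 * (L : ℝ) ^ 2 * δ := by nlinarith

/-- ★ **Signed seam jump**: across a tree edge `e = (x,k)` the seam field jumps by the twist factor,
`fd (g (x+ê_k)) (τ_e · g x) ≤ 16L²·√F^S_z`, `τ_e = centreElem (z k ∧ x_k = 0)`. [cite: tHooft1979] -/
theorem seam_jump_twisted (z : Fin 3 → Bool) (w : OffIdx L → SU2) (r : Fin (2 * L - 1) → GaugeConfig 3 L SU2) (g : Site 3 L → SU2)
    {e : Edge 3 L} (he : treeEdge e = true) :
    fd (g (e.1.shift e.2)) (centreElem (z e.2 && decide (e.1 e.2 = 0)) * g e.1) ≤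
      16 * (L : ℝ) ^ 2 * Real.sqrt (swapRingDeficit L z ((Fin.cons (glue w) r : Fin (2 * L - 1 + 1) → GaugeConfig 3 L SU2), g)) := by
  set P : (Fin (2 * L - 1 + 1) → GaugeConfig 3 L SU2) × (Site 3 L → SU2) := (Fin.cons (glue w) r, g) with hP
  set δ := Real.sqrt (swapRingDeficit L z P) with hδ
  have hδ0 : 0 ≤ δ := Real.sqrt_nonneg _
  have hL1 : (1 : ℝ) ≤ L := by exact_mod_cast NeZero.one_le
  set S : SU2 := configPerm (Equiv.swap (0 : Fin 3) 1) (glue w) e with hSdef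
  set τ : SU2 := centreElem (z e.2 && decide (e.1 e.2 = 0)) with hτ
  have h1 := fd_swapSeam_le z P e
  have hP1 : P.1 0 = glue w := rfl
  have hP2 : P.2 = g := rfl
  rw [hP1, hP2, glue_apply_of_tree w he] at h1
  have e1 : gaugeTransform g (twist3 z (configPerm (Equiv.swap (0 : Fin 3) 1) (glue w))) e =
      g e.1 * (τ * S) * (g (e.1.shift e.2))⁻¹ := by
    rw [show gaugeTransform g (twist3 z (configPerm (Equiv.swap (0 : Fin 3) 1) (glue w))) e =
        g e.1 * twist3 z (configPerm (Equiv.swap (0 : Fin 3) 1) (glue w)) e * (g (e.1.shift e.2))⁻¹ from rfl, twist3_apply, hτ,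
      ite_centreElem]
  rw [e1, ← hδ] at h1
  have h2 : fd S 1 ≤ 12 * (L : ℝ) ^ 2 * δ := fd_configPerm_glue_tree_le z w r g he
  -- `τ` is central: `g x (τ S) g(x')⁻¹ = τ · (g x S g(x')⁻¹)`
  have hcomm : g e.1 * (τ * S) * (g (e.1.shift e.2))⁻¹ = τ * (g e.1 * S * (g (e.1.shift e.2))⁻¹) := by
    rw [← mul_assoc (g e.1) τ S, hτ, ← centreElem_mul_comm _ (g e.1)]; simp only [mul_assoc]
  rw [hcomm] at h1
  -- `fd (g x') (τ g x) = fd (τ g x g(x')⁻¹) 1 ≤ fd (…, τ g x S g(x')⁻¹) + fd (τ g x S g(x')⁻¹) 1`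
  have h4 : fd (g (e.1.shift e.2)) (τ * g e.1) = fd (τ * (g e.1 * 1 * (g (e.1.shift e.2))⁻¹)) 1 := by
    rw [mul_one, ← mul_assoc, fd_mul_inv_one, fd_comm]
  have h3 : fd (τ * (g e.1 * 1 * (g (e.1.shift e.2))⁻¹)) (τ * (g e.1 * S * (g (e.1.shift e.2))⁻¹)) = fd 1 S := by
    rw [fd_mul_left, fd_mul_right, fd_mul_left]
  rw [h4]
  calc fd (τ * (g e.1 * 1 * (g (e.1.shift e.2))⁻¹)) 1
      ≤ fd (τ * (g e.1 * 1 * (g (e.1.shift e.2))⁻¹)) (τ * (g e.1 * S * (g (e.1.shift e.2))⁻¹)) +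
          fd (τ * (g e.1 * S * (g (e.1.shift e.2))⁻¹)) 1 := fd_triangle _ _ _
    _ ≤ 12 * (L : ℝ) ^ 2 * δ + 4 * (L : ℝ) * δ := by
        rw [h3, fd_comm (1 : SU2)]; rw [fd_comm] at h1; exact add_le_add h2 h1
    _ ≤ 16 * (L : ℝ) ^ 2 * δ := by
        have hL2 : (L : ℝ) ≤ (L : ℝ) ^ 2 := le_self_pow₀ hL1 two_ne_zero
        have h := mul_le_mul_of_nonneg_right hL2 hδ0
        nlinarith

/-- ★★ **The sign-stripped seam field is near-constant**: `‖(centreElem(π_z(x))·g 0)⁻¹·g x − 1‖_F ≤ 48L³·√F^S_z` for every site `x`. [cite: tHooft1979] -/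
theorem seam_near_twisted (z : Fin 3 → Bool) (w : OffIdx L → SU2) (r : Fin (2 * L - 1) → GaugeConfig 3 L SU2) (g : Site 3 L → SU2) (x : Site 3 L) :
    frobNorm ((((centreElem (Bool.xor (z 0 && decide (x 0 ≠ 0)) (Bool.xor (z 1 && decide (x 1 ≠ 0)) (z 2 && decide (x 2 ≠ 0)))) * g 0)⁻¹ * g x : SU2) :
        Matrix (Fin 2) (Fin 2) ℂ) - 1) ≤
      48 * (L : ℝ) ^ 3 * Real.sqrt (swapRingDeficit L z ((Fin.cons (glue w) r : Fin (2 * L - 1 + 1) → GaugeConfig 3 L SU2), g)) := by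
  set P : (Fin (2 * L - 1 + 1) → GaugeConfig 3 L SU2) × (Site 3 L → SU2) := (Fin.cons (glue w) r, g) with hP
  set δ := Real.sqrt (swapRingDeficit L z P) with hδ
  have hδ0 : 0 ≤ δ := Real.sqrt_nonneg _
  have hL1 : (1 : ℝ) ≤ L := by exact_mod_cast NeZero.one_le
  -- the stripped field
  set gs : Site 3 L → SU2 := fun y => (centreElem (Bool.xor (z 0 && decide (y 0 ≠ 0)) (Bool.xor (z 1 && decide (y 1 ≠ 0)) (z 2 && decide (y 2 ≠ 0)))))⁻¹ * g y
    with hgs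
  have hjump : ∀ e : Edge 3 L, treeEdge e = true → fd (gs (e.1.shift e.2)) (gs e.1) ≤ 16 * (L : ℝ) ^ 2 * δ := by
    intro e he
    have hx : e.1 e.2 ≠ -1 := apply_ne_neg_one_of_treeEdge he
    have hpar := parity_shift z e.1 e.2 hx
    have h := seam_jump_twisted z w r g he
    rw [← hδ] at h
    -- `gs (x') = (τ·χ(x))⁻¹ g x'`, `gs x = χ(x)⁻¹ g x`
    simp only [hgs]
    rw [hpar, fd_strip]
    exact h
  have hρ0 : 0 ≤ 16 * (L : ℝ) ^ 2 * δ := by positivity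
  have hgs0 : gs 0 = g 0 := by
    simp only [hgs, parity_zero]
    simp [centreElem]
  have h := fd_sub_base_le_of_treeEdge hρ0 hjump x
  rw [hgs0] at h
  rw [frobNorm_inv_mul_sub_one_eq_fd, ← fd_mul_left ((centreElem (Bool.xor (z 0 && decide (x 0 ≠ 0)) (Bool.xor (z 1 && decide (x 1 ≠ 0)) (z 2 && decide (x 2 ≠ 0)))))⁻¹),
    ← mul_assoc, inv_mul_cancel, one_mul]
  calc fd _ (g 0) ≤ 3 * ((L : ℝ) - 1) * (16 * (L : ℝ) ^ 2 * δ) := h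
    _ ≤ 48 * (L : ℝ) ^ 3 * δ := by nlinarith

/-! ## §3 The signed σ-relations of the leaders -/

omit [NeZero L] in
/-- The axis swap maps the leader edge of direction `k` to the leader edge of direction `σ k`. [folklore] -/
theorem configPerm_swap_leader (U : GaugeConfig 3 L SU2) (k : Fin 3) :
    configPerm (Equiv.swap (0 : Fin 3) 1) U ((Pi.single k (-1 : ZMod L), k) : Edge 3 L) =
      U (Pi.single (Equiv.swap (0 : Fin 3) 1 k) (-1 : ZMod L), Equiv.swap (0 : Fin 3) 1 k) := by
  rw [configPerm_apply]
  congr 1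
  ext j
  · simp only [sitePerm_apply, Equiv.symm_swap]
    fin_cases k <;> fin_cases j <;> simp [Equiv.swap_apply_def]
  · simp [Equiv.symm_swap]

/-- ★★ **Signed σ-relation**: `‖g0·C_{σk} − centreElem(z k)·C_k·g0‖_F ≤ 52L³·√F^S_z`. [cite: tHooft1979] [cite: Luscher1983, §2] -/
theorem seam_wrap_twisted (z : Fin 3 → Bool) (w : OffIdx L → SU2) (r : Fin (2 * L - 1) → GaugeConfig 3 L SU2) (g : Site 3 L → SU2) (k : Fin 3) :
    frobNorm (((g 0 * w ⟨(Pi.single (Equiv.swap (0 : Fin 3) 1 k) (-1 : ZMod L), Equiv.swap (0 : Fin 3) 1 k),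
        leader_not_treeEdge (Equiv.swap (0 : Fin 3) 1 k)⟩ : SU2) : Matrix (Fin 2) (Fin 2) ℂ) -
      ((centreElem (z k) * w ⟨(Pi.single k (-1 : ZMod L), k), leader_not_treeEdge k⟩ * g 0 : SU2) : Matrix (Fin 2) (Fin 2) ℂ)) ≤
      52 * (L : ℝ) ^ 3 * Real.sqrt (swapRingDeficit L z ((Fin.cons (glue w) r : Fin (2 * L - 1 + 1) → GaugeConfig 3 L SU2), g)) := by
  set P : (Fin (2 * L - 1 + 1) → GaugeConfig 3 L SU2) × (Site 3 L → SU2) := (Fin.cons (glue w) r, g) with hP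
  set δ := Real.sqrt (swapRingDeficit L z P) with hδ
  have hδ0 : 0 ≤ δ := Real.sqrt_nonneg _
  have hL1 : (1 : ℝ) ≤ L := by exact_mod_cast NeZero.one_le
  set c : SU2 := g 0 with hc
  set W : SU2 := w ⟨(Pi.single k (-1 : ZMod L), k), leader_not_treeEdge k⟩ with hW
  set W' : SU2 := w ⟨(Pi.single (Equiv.swap (0 : Fin 3) 1 k) (-1 : ZMod L), Equiv.swap (0 : Fin 3) 1 k),
    leader_not_treeEdge (Equiv.swap (0 : Fin 3) 1 k)⟩ with hW'
  set m : Site 3 L := (Pi.single k (-1 : ZMod L) : Site 3 L) with hm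
  -- the wrap edge ends at the origin
  have hshift : m.shift k = 0 := by
    rw [hm, ← mk3_wrap_eq_single]; exact wrapEdge_shift k
  have hWk : glue w (m, k) = W := glue_apply_of_not_tree w (leader_not_treeEdge k)
  have hW'k : configPerm (Equiv.swap (0 : Fin 3) 1) (glue w) (m, k) = W' := by
    rw [hm, configPerm_swap_leader, glue_apply_of_not_tree w (leader_not_treeEdge _)]
  -- twist factor at the wrap edge and parity at the wrap site
  set τ : SU2 := centreElem (z k && decide (m k = 0)) with hτ
  set χ : SU2 := centreElem (Bool.xor (z 0 && decide (m 0 ≠ 0)) (Bool.xor (z 1 && decide (m 1 ≠ 0)) (z 2 && decide (m 2 ≠ 0)))) with hχ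
  have hτχ : χ * τ = centreElem (z k) := by
    rw [hχ, hτ, centreElem_mul]
    have h := parity_wrap_xor (L := L) z k
    rw [Bool.xor_comm] at h
    exact congrArg centreElem h
  -- the seam bond at the wrap edge: `fd W (g m · τ W' · c⁻¹) ≤ 4Lδ`
  have h1 := fd_swapSeam_le z P (m, k)
  have hP1 : P.1 0 = glue w := rfl
  have hP2 : P.2 = g := rfl
  rw [hP1, hP2] at h1
  have e1 : gaugeTransform g (twist3 z (configPerm (Equiv.swap (0 : Fin 3) 1) (glue w))) (m, k) = g m * (τ * W') * c⁻¹ := by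
    rw [show gaugeTransform g (twist3 z (configPerm (Equiv.swap (0 : Fin 3) 1) (glue w))) (m, k) =
        g m * twist3 z (configPerm (Equiv.swap (0 : Fin 3) 1) (glue w)) (m, k) * (g (m.shift k))⁻¹ from rfl, twist3_apply, hshift, hW'k, hτ,
      ite_centreElem]
  rw [e1, hWk, ← hδ] at h1
  -- the stripped seam value at `m`: `fd (g m) (χ c) ≤ 48L³δ`
  have h2 : fd (g m) (χ * c) ≤ 48 * (L : ℝ) ^ 3 * δ := by
    have h := seam_near_twisted z w r g m
    rw [frobNorm_inv_mul_sub_one_eq_fd, ← hδ] at h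
    exact h
  -- combine: `fd W (centreElem(z k)·c·W'·c⁻¹) ≤ 52L³δ`
  have h3 : fd (g m * (τ * W') * c⁻¹) (χ * c * (τ * W') * c⁻¹) = fd (g m) (χ * c) := by rw [fd_mul_right, fd_mul_right]
  have hkey : χ * c * (τ * W') * c⁻¹ = centreElem (z k) * (c * W' * c⁻¹) := by
    rw [← hτχ]
    simp only [mul_assoc]
    congr 1
    rw [← mul_assoc c τ, ← centreElem_mul_comm, hτ]
    simp only [mul_assoc, centreElem_mul_comm]
  have hWc : fd W (centreElem (z k) * (c * W' * c⁻¹)) ≤ 52 * (L : ℝ) ^ 3 * δ := by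
    rw [← hkey]
    calc fd W (χ * c * (τ * W') * c⁻¹) ≤ fd W (g m * (τ * W') * c⁻¹) + fd (g m * (τ * W') * c⁻¹) (χ * c * (τ * W') * c⁻¹) := fd_triangle _ _ _
      _ ≤ 4 * (L : ℝ) * δ + 48 * (L : ℝ) ^ 3 * δ := by rw [h3]; exact add_le_add h1 h2
      _ ≤ 52 * (L : ℝ) ^ 3 * δ := by
          have hL3 : (L : ℝ) ≤ (L : ℝ) ^ 3 := le_self_pow₀ hL1 (by norm_num)
          have h := mul_le_mul_of_nonneg_right hL3 hδ0
          nlinarith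
  -- `‖cW' − ε W c‖_F = fd (cW') (εWc) = fd (cW'c⁻¹) (εW) = fd (ε·cW'c⁻¹) W`  (`ε² = 1`)
  have e2 : frobNorm (((c * W' : SU2) : Matrix (Fin 2) (Fin 2) ℂ) - ((centreElem (z k) * W * c : SU2) : Matrix (Fin 2) (Fin 2) ℂ)) =
      fd (c * W') (centreElem (z k) * W * c) := rfl
  rw [e2, ← fd_mul_right c⁻¹ (c * W') (centreElem (z k) * W * c), mul_inv_cancel_right,
    ← fd_mul_left (centreElem (z k)) (c * W' * c⁻¹) (centreElem (z k) * W), ← mul_assoc (centreElem (z k)) (centreElem (z k)) W,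
    centreElem_mul_self, one_mul, fd_comm]
  exact hWc

/-! ## §4 The twisted box -/

/-- ★★ **A small σ-glued deficit puts the tree-gauged ring history INTO the SIGNED σ-twisted box** (every sector `z`): with `δ = √F^S_z(glue w ∷ r, g)`,
the wrap links pairwise commute up to `52L³δ`, the seam value intertwines `C_{σμ}` and `centreElem(z μ)·C_μ` up to `52L³δ`, the other off-tree links are
within `48L³δ` of their letters, the slices within `48L³δ` of slice `0`, and the seam field within `48L³δ` of `centreElem(π_z(x))·g 0`.
[cite: tHooft1979] [cite: Luscher1983, §2] -/
theorem swapCommBox_of_swapRingDeficit_twisted (z : Fin 3 → Bool) (w : OffIdx L → SU2) (r : Fin (2 * L - 1) → GaugeConfig 3 L SU2)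
    (g : Site 3 L → SU2) :
    (∀ μ ν : Fin 3,
      frobNorm (((w ⟨(Pi.single μ (-1 : ZMod L), μ), leader_not_treeEdge μ⟩ * w ⟨(Pi.single ν (-1 : ZMod L), ν), leader_not_treeEdge ν⟩ : SU2) :
          Matrix (Fin 2) (Fin 2) ℂ) -
        ((w ⟨(Pi.single ν (-1 : ZMod L), ν), leader_not_treeEdge ν⟩ * w ⟨(Pi.single μ (-1 : ZMod L), μ), leader_not_treeEdge μ⟩ : SU2) :
          Matrix (Fin 2) (Fin 2) ℂ)) ≤
        52 * (L : ℝ) ^ 3 * Real.sqrt (swapRingDeficit L z ((Fin.cons (glue w) r : Fin (2 * L - 1 + 1) → GaugeConfig 3 L SU2), g))) ∧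
    (∀ μ : Fin 3,
      frobNorm (((g 0 * w ⟨(Pi.single (Equiv.swap (0 : Fin 3) 1 μ) (-1 : ZMod L), Equiv.swap (0 : Fin 3) 1 μ),
          leader_not_treeEdge (Equiv.swap (0 : Fin 3) 1 μ)⟩ : SU2) : Matrix (Fin 2) (Fin 2) ℂ) -
        ((centreElem (z μ) * w ⟨(Pi.single μ (-1 : ZMod L), μ), leader_not_treeEdge μ⟩ * g 0 : SU2) : Matrix (Fin 2) (Fin 2) ℂ)) ≤
        52 * (L : ℝ) ^ 3 * Real.sqrt (swapRingDeficit L z ((Fin.cons (glue w) r : Fin (2 * L - 1 + 1) → GaugeConfig 3 L SU2), g))) ∧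
    (∀ i : OffIdx L, frobNorm ((((if i.1.1 i.1.2 = -1 then w ⟨(Pi.single i.1.2 (-1 : ZMod L), i.1.2), leader_not_treeEdge i.1.2⟩
        else 1)⁻¹ * w i : SU2) : Matrix (Fin 2) (Fin 2) ℂ) - 1) ≤
        48 * (L : ℝ) ^ 3 * Real.sqrt (swapRingDeficit L z ((Fin.cons (glue w) r : Fin (2 * L - 1 + 1) → GaugeConfig 3 L SU2), g))) ∧
    (∀ (j : Fin (2 * L - 1)) (e : Edge 3 L), frobNorm ((((glue w e)⁻¹ * r j e : SU2) : Matrix (Fin 2) (Fin 2) ℂ) - 1) ≤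
        48 * (L : ℝ) ^ 3 * Real.sqrt (swapRingDeficit L z ((Fin.cons (glue w) r : Fin (2 * L - 1 + 1) → GaugeConfig 3 L SU2), g))) ∧
    (∀ x : Site 3 L, frobNorm ((((centreElem (Bool.xor (z 0 && decide (x 0 ≠ 0)) (Bool.xor (z 1 && decide (x 1 ≠ 0)) (z 2 && decide (x 2 ≠ 0)))) * g 0)⁻¹ *
        g x : SU2) : Matrix (Fin 2) (Fin 2) ℂ) - 1) ≤
        48 * (L : ℝ) ^ 3 * Real.sqrt (swapRingDeficit L z ((Fin.cons (glue w) r : Fin (2 * L - 1 + 1) → GaugeConfig 3 L SU2), g))) := by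
  have hδ0 : 0 ≤ Real.sqrt (swapRingDeficit L z ((Fin.cons (glue w) r : Fin (2 * L - 1 + 1) → GaugeConfig 3 L SU2), g)) := Real.sqrt_nonneg _
  have hL1 : (1 : ℝ) ≤ L := by exact_mod_cast NeZero.one_le
  have hL3 : (L : ℝ) ≤ (L : ℝ) ^ 3 := le_self_pow₀ hL1 (by norm_num)
  have hL23 : (L : ℝ) ^ 2 ≤ (L : ℝ) ^ 3 := pow_le_pow_right₀ hL1 (by norm_num)
  have h20 : 20 * (L : ℝ) ^ 2 ≤ 52 * (L : ℝ) ^ 3 := by nlinarith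
  have h12 : 12 * (L : ℝ) ^ 2 ≤ 48 * (L : ℝ) ^ 3 := by nlinarith
  have h4 : 4 * (L : ℝ) ≤ 48 * (L : ℝ) ^ 3 := by nlinarith
  exact ⟨fun μ ν => (swap_wraps_comm z w r g μ ν).trans (mul_le_mul_of_nonneg_right h20 hδ0), fun μ => seam_wrap_twisted z w r g μ,
    fun i => (swap_letters_near z w r g i).trans (mul_le_mul_of_nonneg_right h12 hδ0),
    fun j e => (swap_slices_near z w r g j e).trans (mul_le_mul_of_nonneg_right h4 hδ0), fun x => seam_near_twisted z w r g x⟩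

/-! ## §5 The box in the `hbox` shape of the sector Fubini (level sets `F^S_z ≤ u`) -/

/-- ★★ **`hbox` form** (w3 g61's interface `ringMeasure_real_swapDeficit_le_le_box_of_box`): on the level set `F^S_z ≤ u` the tree-gauged history lies
in the SIGNED box with `s = 52L³√u`, `t₂ = 48L³√u`, signs `ε μ = centreElem (z μ)` and centre character `χ x = centreElem(π_z(x))`.
[cite: tHooft1979] [cite: Luscher1983, §2] -/
theorem swapBox_of_swapRingDeficit_le (z : Fin 3 → Bool) (u : ℝ) (w : OffIdx L → SU2) (r : Fin (2 * L - 1) → GaugeConfig 3 L SU2)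
    (g : Site 3 L → SU2) (hu : swapRingDeficit L z ((Fin.cons (glue w) r : Fin (2 * L - 1 + 1) → GaugeConfig 3 L SU2), g) ≤ u) :
    (∀ μ ν : Fin 3,
      frobNorm (((w ⟨(Pi.single μ (-1 : ZMod L), μ), leader_not_treeEdge μ⟩ * w ⟨(Pi.single ν (-1 : ZMod L), ν), leader_not_treeEdge ν⟩ : SU2) :
          Matrix (Fin 2) (Fin 2) ℂ) -
        ((w ⟨(Pi.single ν (-1 : ZMod L), ν), leader_not_treeEdge ν⟩ * w ⟨(Pi.single μ (-1 : ZMod L), μ), leader_not_treeEdge μ⟩ : SU2) :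
          Matrix (Fin 2) (Fin 2) ℂ)) ≤ 52 * (L : ℝ) ^ 3 * Real.sqrt u) ∧
    (∀ μ : Fin 3,
      frobNorm (((g 0 * w ⟨(Pi.single (Equiv.swap (0 : Fin 3) 1 μ) (-1 : ZMod L), Equiv.swap (0 : Fin 3) 1 μ),
          leader_not_treeEdge (Equiv.swap (0 : Fin 3) 1 μ)⟩ : SU2) : Matrix (Fin 2) (Fin 2) ℂ) -
        ((centreElem (z μ) * w ⟨(Pi.single μ (-1 : ZMod L), μ), leader_not_treeEdge μ⟩ * g 0 : SU2) : Matrix (Fin 2) (Fin 2) ℂ)) ≤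
        52 * (L : ℝ) ^ 3 * Real.sqrt u) ∧
    (∀ i : OffIdx L, frobNorm ((((if i.1.1 i.1.2 = -1 then w ⟨(Pi.single i.1.2 (-1 : ZMod L), i.1.2), leader_not_treeEdge i.1.2⟩
        else 1)⁻¹ * w i : SU2) : Matrix (Fin 2) (Fin 2) ℂ) - 1) ≤ 48 * (L : ℝ) ^ 3 * Real.sqrt u) ∧
    (∀ (j : Fin (2 * L - 1)) (e : Edge 3 L), frobNorm ((((glue w e)⁻¹ * r j e : SU2) : Matrix (Fin 2) (Fin 2) ℂ) - 1) ≤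
        48 * (L : ℝ) ^ 3 * Real.sqrt u) ∧
    (∀ x : Site 3 L, x ≠ 0 → frobNorm ((((centreElem (Bool.xor (z 0 && decide (x 0 ≠ 0)) (Bool.xor (z 1 && decide (x 1 ≠ 0))
        (z 2 && decide (x 2 ≠ 0)))) * g 0)⁻¹ * g x : SU2) : Matrix (Fin 2) (Fin 2) ℂ) - 1) ≤ 48 * (L : ℝ) ^ 3 * Real.sqrt u) := by
  obtain ⟨hCC, hσ, hw, hr, hg⟩ := swapCommBox_of_swapRingDeficit_twisted z w r g
  have hδ : Real.sqrt (swapRingDeficit L z ((Fin.cons (glue w) r : Fin (2 * L - 1 + 1) → GaugeConfig 3 L SU2), g)) ≤ Real.sqrt u :=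
    Real.sqrt_le_sqrt hu
  have h52 : (0 : ℝ) ≤ 52 * (L : ℝ) ^ 3 := by positivity
  have h48 : (0 : ℝ) ≤ 48 * (L : ℝ) ^ 3 := by positivity
  have hs := mul_le_mul_of_nonneg_left hδ h52
  have ht := mul_le_mul_of_nonneg_left hδ h48
  exact ⟨fun μ ν => (hCC μ ν).trans hs, fun μ => (hσ μ).trans hs, fun i => (hw i).trans ht, fun j e => (hr j e).trans ht,
    fun x _ => (hg x).trans ht⟩

end Summit.QuantumFields.YangMills.Theorems.SwapVirialDeficit.SwapRingTwisted

end
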